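import Literature.NumberTheory.GelbartRogawski1991.UnitaryDualPairThetaLiftGaussianCharacter
import HarnessLib

-- As in the lineage (`UnitaryDualPairThetaKernelGaussian`, `…ThetaLiftGaussianCMLine`, `…ThetaLiftGaussianCharacter`;
-- ops-buildfix G11b-3): statements over the theta-kernel datum elaborate to very large types; elaborate sequentially.
set_option Elab.async false

/-!
# The theta lifts of automorphic characters span the theta correspondence from a compact abelian second member

Topic `NumberTheory/GelbartRogawski1991`; namespaces `Literature.RepresentationTheory.CompactGroups` (§0, density of
characters), `Literature.NumberTheory.Weil1964.ThetaKernelDatum` (§1, generic dual-pair theta datum) and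
`Literature.NumberTheory.GelbartRogawski1991.UnitaryDualPair` (§2, the CM line of [GelbartRogawski1991]).
Continues `UnitaryDualPairThetaLiftGaussianCharacter` (there, §0/§2: SOME automorphic character `χ` of the compact
abelian group `[U(⟨d_W⟩)]` has `Θ_{Φ_G}(χ) ≠ 0`).  KERNEL file: THEOREMS ONLY (no definition, no instance, no named
fact, no `sorry`).

* §0 `mem_closure_span_range_charCM` — on a compact Hausdorff ABELIAN group `K` the continuous unitary characters
  span a sup-norm DENSE subspace of `C(K, ℂ)` (Pontryagin–van Kampen separation, tree `charSeparating`, and the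
  Stone–Weierstrass theorem for the star-subalgebra `span {χ}`, tree `spanStarSubalgebra`).
* §1 `ThetaKernelDatum.thetaLift_mem_closure_span_charCM` — for a dual-pair theta datum with compact Hausdorff
  ABELIAN second member `G ⧸ Γ` and any finite Borel measure `μ`: **every theta lift `Θ_Φ(f)`, `f ∈ C(G ⧸ Γ, ℂ)`,
  is a sup-norm limit of finite linear combinations of the theta lifts `Θ_Φ(χ)` of automorphic characters** — the
  lift is continuous and linear in `f` (tree `continuous_thetaLift_right`, `thetaLift_add/_smul`); hence
  (`thetaLift_eq_zero_iff_forall_charCM`) `Θ_Φ ≡ 0` on `C(G ⧸ Γ, ℂ)` iff `Θ_Φ(χ) = 0` for every character `χ`: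
  the character theta lifts GENERATE the theta correspondence `f ↦ Θ_Φ(f)` [FleigEtAl2018, (12.37)].
* §2 the CM line `(U(diag d_V), U(⟨d_W⟩))`: `cmThetaKernelDatum_line_thetaLift_mem_closure_span_charCM`,
  `cmThetaKernelDatum_line_thetaLift_eq_zero_iff_forall_charCM` (any majorants, any index set, any finite Borel
  measure); with `UnitaryDualPairThetaLiftGaussianCharacter` §2 the closed span of the character lifts of the
  Gaussian is non-zero modulo `hGR`.

## References
* A. Deitmar, S. Echterhoff, *Principles of Harmonic Analysis*, 2nd ed. (2014), Prop. 3.5.2 (Pontryagin–van Kampen)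
  [DeitmarEchterhoff2014].
* P. Fleig, H. P. A. Gustafsson, A. Kleinschmidt, D. Persson, *Eisenstein Series and Automorphic Representations* (2018),
  §12.3 Definition 12.5 (12.37), printed p. 296 [FleigEtAl2018].
* S. Gelbart, J. Rogawski, *L-functions and Fourier–Jacobi coefficients for the unitary group U(3)*, Invent. Math. 105
  (1991), §3.2 p. 457 [GelbartRogawski1991].

## Provenance
Lane `lit-hodgefound` (HOME `run/shared/lean/pub/lit-hodgefound/`), prover seat `lit-hodgefound-p05` generation 5, fifth
file.
-/

set_option autoImplicit false

noncomputable section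

open scoped Matrix ComplexConjugate ComplexOrder
open NumberField NumberField.mixedEmbedding IsDedekindDomain
open _root_.MeasureTheory
open Literature.NumberTheory.Automorphic
open Literature.AlgebraicGeometry.ShimuraVarieties (hermForm)

/-! ## §0. Characters of a compact abelian group span a dense subspace of `C(K, ℂ)` -/

namespace Literature.RepresentationTheory.CompactGroups

/-- **The continuous unitary characters of a compact Hausdorff abelian group `K` span a sup-norm dense subspace of
`C(K, ℂ)`**: every `f ∈ C(K, ℂ)` lies in the closure of `span_ℂ {χ}` — the span is a star-subalgebra containing `1`
(`charCM_one/_mul`, `star_charCM`) which separates points by the Pontryagin–van Kampen theorem (`charSeparating`),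
so the Stone–Weierstrass theorem applies. [cite: DeitmarEchterhoff2014, Prop. 3.5.2] -/
theorem mem_closure_span_range_charCM {K : Type*} [CommGroup K] [TopologicalSpace K] [IsTopologicalGroup K]
    [CompactSpace K] [T2Space K] (f : C(K, ℂ)) :
    f ∈ closure (Submodule.span ℂ (Set.range (charCM (K := K))) : Set C(K, ℂ)) := by
  let A : StarSubalgebra ℂ C(K, ℂ) := spanStarSubalgebra (Set.range (charCM (K := K))) ⟨1, charCM_one⟩
    (by
      rintro _ ⟨χ, rfl⟩ _ ⟨ψ, rfl⟩
      exact ⟨χ * ψ, (charCM_mul χ ψ).symm⟩)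
    (by
      rintro _ ⟨χ, rfl⟩
      exact ⟨χ⁻¹, (star_charCM χ).symm⟩)
  have hA : A.SeparatesPoints := by
    intro k₁ k₂ hk
    obtain ⟨χ, hχ⟩ := charSeparating k₁ k₂ hk
    exact ⟨charCM χ, ⟨charCM χ, Submodule.subset_span ⟨χ, rfl⟩, rfl⟩, fun h => hχ (Circle.ext h)⟩
  have htop := ContinuousMap.starSubalgebra_topologicalClosure_eq_top_of_separatesPoints A hA
  have hf : f ∈ A.topologicalClosure := by
    rw [htop]
    exact StarSubalgebra.mem_top
  exact hf

end Literature.RepresentationTheory.CompactGroups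

/-! ## §1. Generic: the character theta lifts generate the theta correspondence -/

namespace Literature.NumberTheory.Weil1964.ThetaKernelDatum

open Literature.RepresentationTheory.CompactGroups

variable {Mp : Type*} {SX : Type*} [TopologicalSpace Mp] [Group Mp] [TopologicalSpace SX]
variable {GU : Type*} [Group GU] [TopologicalSpace GU] [IsTopologicalGroup GU] {ΓU : Subgroup GU}
variable {G : Type*} [CommGroup G] [TopologicalSpace G] [IsTopologicalGroup G] {Γ : Subgroup G}
variable (M : ThetaKernelDatum Mp SX GU ΓU G Γ)
variable [CompactSpace (GU ⧸ ΓU)] [CompactSpace (G ⧸ Γ)] [T2Space (G ⧸ Γ)] [MeasurableSpace (G ⧸ Γ)]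
  [BorelSpace (G ⧸ Γ)] (μ : Measure (G ⧸ Γ)) [IsFiniteMeasure μ]

/-- **Every theta lift is a sup-norm limit of finite linear combinations of the theta lifts of automorphic
characters.**  For a dual-pair theta datum whose second member `G ⧸ Γ` is a compact Hausdorff ABELIAN group, a finite
Borel measure `μ` on it, a Schwartz vector `Φ` and `f ∈ C(G ⧸ Γ, ℂ)`:
`Θ_Φ(f) ∈ closure (span_ℂ {Θ_Φ(χ) : χ ∈ PontryaginDual (G ⧸ Γ)})` in `C(GU ⧸ ΓU, ℂ)` — the characters span a dense
subspace of `C(G ⧸ Γ, ℂ)` (§0) and `f ↦ Θ_Φ(f) = ∫ θ_Φ(·, q) f(q) dμ(q)` is linear and sup-norm continuous.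
[cite: FleigEtAl2018, §12.3 Definition 12.5 (12.37), p. 296; DeitmarEchterhoff2014, Prop. 3.5.2] -/
theorem thetaLift_mem_closure_span_charCM (Φ : SX) (f : C(G ⧸ Γ, ℂ)) :
    M.thetaLift μ Φ f ∈
      closure (Submodule.span ℂ (Set.range fun χ : PontryaginDual (G ⧸ Γ) => M.thetaLift μ Φ (charCM χ)) :
        Set C(GU ⧸ ΓU, ℂ)) := by
  -- the lift as a linear map in `f`
  let T : C(G ⧸ Γ, ℂ) →ₗ[ℂ] C(GU ⧸ ΓU, ℂ) :=
    { toFun := fun g => M.thetaLift μ Φ g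
      map_add' := fun g g' => M.thetaLift_add μ Φ g g'
      map_smul' := fun c g => M.thetaLift_smul μ Φ c g }
  have hT : Continuous T := M.continuous_thetaLift_right μ Φ
  have hmaps : Set.MapsTo T (Submodule.span ℂ (Set.range (charCM (K := G ⧸ Γ))) : Set C(G ⧸ Γ, ℂ))
      (Submodule.span ℂ (Set.range fun χ : PontryaginDual (G ⧸ Γ) => M.thetaLift μ Φ (charCM χ)) :
        Set C(GU ⧸ ΓU, ℂ)) := by
    intro p hp
    have hp' : T p ∈ (Submodule.span ℂ (Set.range (charCM (K := G ⧸ Γ)))).map T := Submodule.mem_map_of_mem hp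
    rw [Submodule.map_span, ← Set.range_comp] at hp'
    exact hp'
  exact map_mem_closure hT (mem_closure_span_range_charCM f) hmaps

/-- **The theta lifts of characters detect the vanishing of the theta correspondence**: if `Θ_Φ(χ) = 0` for every
continuous unitary character `χ` of the compact abelian group `G ⧸ Γ`, then `Θ_Φ(f) = 0` for every `f ∈ C(G ⧸ Γ, ℂ)`
(the closed span of `{0}` is `{0}`). [cite: FleigEtAl2018, §12.3 Definition 12.5 (12.37), p. 296; DeitmarEchterhoff2014,
Prop. 3.5.2] -/
theorem thetaLift_eq_zero_of_forall_charCM {Φ : SX}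
    (h : ∀ χ : PontryaginDual (G ⧸ Γ), M.thetaLift μ Φ (charCM χ) = 0) (f : C(G ⧸ Γ, ℂ)) :
    M.thetaLift μ Φ f = 0 := by
  have hmem := M.thetaLift_mem_closure_span_charCM μ Φ f
  have hbot : Submodule.span ℂ (Set.range fun χ : PontryaginDual (G ⧸ Γ) => M.thetaLift μ Φ (charCM χ)) = ⊥ := by
    rw [Submodule.span_eq_bot]
    rintro _ ⟨χ, rfl⟩
    exact h χ
  rw [hbot, Submodule.bot_coe, closure_singleton] at hmem
  exact hmem

/-- **`Θ_Φ ≡ 0` on `C(G ⧸ Γ, ℂ)` iff `Θ_Φ(χ) = 0` for every automorphic character `χ`** (compact Hausdorff abelian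
second member, any finite Borel measure): the character theta lifts generate the theta correspondence at level `Φ`.
[cite: FleigEtAl2018, §12.3 Definition 12.5 (12.37), p. 296; DeitmarEchterhoff2014, Prop. 3.5.2] -/
theorem thetaLift_eq_zero_iff_forall_charCM (Φ : SX) :
    (∀ f : C(G ⧸ Γ, ℂ), M.thetaLift μ Φ f = 0) ↔
      ∀ χ : PontryaginDual (G ⧸ Γ), M.thetaLift μ Φ (charCM χ) = 0 :=
  ⟨fun h χ => h (charCM χ), fun h f => M.thetaLift_eq_zero_of_forall_charCM μ h f⟩

/-- … contrapositive: a theta lift `Θ_Φ(f) ≠ 0` of SOME continuous `f` forces a non-zero character lift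
`Θ_Φ(χ) ≠ 0` (no positivity hypothesis on `μ`; compare `exists_character_thetaLift_ne_zero_fun`, which needs `μ`
charging open sets but only `θ_Φ(ξ₀, ·) ≠ 0`). [cite: FleigEtAl2018, §12.3 Definition 12.5 (12.37), p. 296;
DeitmarEchterhoff2014, Prop. 3.5.2] -/
theorem exists_character_thetaLift_ne_zero_of_thetaLift_ne_zero {Φ : SX} {f : C(G ⧸ Γ, ℂ)}
    (hf : M.thetaLift μ Φ f ≠ 0) : ∃ χ : PontryaginDual (G ⧸ Γ), M.thetaLift μ Φ (charCM χ) ≠ 0 := by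
  by_contra h
  exact hf (M.thetaLift_eq_zero_of_forall_charCM μ (fun χ => not_not.mp fun hχ => h ⟨χ, hχ⟩) f)

end Literature.NumberTheory.Weil1964.ThetaKernelDatum

/-! ## §2. The CM line `(U(diag d_V), U(⟨d_W⟩))` -/

namespace Literature.NumberTheory.GelbartRogawski1991

namespace UnitaryDualPair

open Literature.NumberTheory.Weil1964
open Literature.RepresentationTheory.CompactGroups

section Line

variable (L : Type) [Field L] [NumberField L] [IsCMField L]

/-- `U(⟨d_W⟩)(𝔸_{L⁺}) ⊂ GL₁(𝔸_L)` is commutative (`1 × 1` matrices over a commutative ring). [folklore] -/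
private theorem adelic_line_mul_comm (dW : Fin 1 → L)
    (a b : ↥(UnitaryGroup.adelic ↥(maximalRealSubfield L) L (IsCMField.complexConj L) 1 (Matrix.diagonal dW))) :
    a * b = b * a := by
  apply Subtype.ext
  show (a : GL (Fin 1) (AdeleRing (𝓞 L) L)) * b = b * a
  ext i j
  simp [Units.val_mul, Matrix.mul_apply, Subsingleton.elim i 0, Subsingleton.elim j 0, mul_comm]

/-- The rational points `U(⟨d_W⟩)(L⁺)` form a NORMAL subgroup of the commutative group `U(⟨d_W⟩)(𝔸_{L⁺})`.
[folklore] -/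
private theorem normal_range_toAdelic_line (dW : Fin 1 → L) :
    (UnitaryGroup.toAdelic ↥(maximalRealSubfield L) L (IsCMField.complexConj L) 1 (Matrix.diagonal dW)).range.Normal :=
  ⟨fun m hm g => by rwa [adelic_line_mul_comm L dW g m, mul_inv_cancel_right]⟩

variable {N n : ℕ} (e : Fin N × Fin 1 ≃ Fin n)
variable (dV : Fin N → L) (hdV : ∀ i, IsCMField.complexConj L (dV i) = dV i) (hdV0 : ∀ i, dV i ≠ 0)
variable (dW : Fin 1 → L) (hdW : ∀ i, IsCMField.complexConj L (dW i) = dW i) (hdW0 : ∀ i, dW i ≠ 0)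
variable (hGR : (cmSplittingDatum L e dV hdV hdV0 dW hdW hdW0).CompatibleSplitting)
  (hρ : HasThetaMajorants fun
    (p : ↥(UnitaryGroup.adelic ↥(maximalRealSubfield L) L (IsCMField.complexConj L) N (Matrix.diagonal dV)) ×
      ↥(UnitaryGroup.adelic ↥(maximalRealSubfield L) L (IsCMField.complexConj L) 1 (Matrix.diagonal dW)))
    (Φ : piSchwartzBruhat ↥(maximalRealSubfield L) (Fin n)) =>
      adelicMpCont.omega ↥(maximalRealSubfield L) (Fin n)
        (adelicGram ↥(maximalRealSubfield L) e (realDiagonal L dV hdV) (realDiagonal L dW hdW))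
        (cmPairSplitting L e dV hdV hdV0 dW hdW hdW0 hGR p) Φ)
  (SK : Set (piSchwartzBruhat ↥(maximalRealSubfield L) (Fin n)))
  (hSK : ∀ (h : ↥(UnitaryGroup.adelic ↥(maximalRealSubfield L) L (IsCMField.complexConj L) 1 (Matrix.diagonal dW)))
    (Φ : piSchwartzBruhat ↥(maximalRealSubfield L) (Fin n)), Φ ∈ SK →
      cmPairRep L e dV hdV hdV0 dW hdW hdW0 hGR (1, h) Φ ∈ SK)

/-- **THE THETA LIFTS OF AUTOMORPHIC CHARACTERS SPAN THE THETA CORRESPONDENCE FROM THE CM LINE.**  For the CM pair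
`(U(diag d_V), U(⟨d_W⟩))` (over a compact `[U(diag d_V)]`; any majorant witness `hρ`, any index set `SK`), every
finite Borel measure `μ` on the compact abelian group `[U(⟨d_W⟩)]`, every Schwartz–Bruhat `Φ` and every
`f ∈ C([U(⟨d_W⟩)], ℂ)`: the theta lift `Θ_Φ(f) ∈ C([U(diag d_V)], ℂ)` is a sup-norm limit of finite linear combinations
of the theta lifts `Θ_Φ(χ)` of continuous unitary characters `χ` of `[U(⟨d_W⟩)]`.
[cite: GelbartRogawski1991, §3.2 p. 457; FleigEtAl2018, §12.3 Definition 12.5 (12.37), p. 296; DeitmarEchterhoff2014,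
Prop. 3.5.2] -/
theorem cmThetaKernelDatum_line_thetaLift_mem_closure_span_charCM
    [CompactSpace (↥(UnitaryGroup.adelic ↥(maximalRealSubfield L) L (IsCMField.complexConj L) N (Matrix.diagonal dV)) ⧸
      (UnitaryGroup.toAdelic ↥(maximalRealSubfield L) L (IsCMField.complexConj L) N (Matrix.diagonal dV)).range)]
    [MeasurableSpace (↥(UnitaryGroup.adelic ↥(maximalRealSubfield L) L (IsCMField.complexConj L) 1 (Matrix.diagonal dW)) ⧸
      (UnitaryGroup.toAdelic ↥(maximalRealSubfield L) L (IsCMField.complexConj L) 1 (Matrix.diagonal dW)).range)]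
    [BorelSpace (↥(UnitaryGroup.adelic ↥(maximalRealSubfield L) L (IsCMField.complexConj L) 1 (Matrix.diagonal dW)) ⧸
      (UnitaryGroup.toAdelic ↥(maximalRealSubfield L) L (IsCMField.complexConj L) 1 (Matrix.diagonal dW)).range)]
    (μ : Measure (↥(UnitaryGroup.adelic ↥(maximalRealSubfield L) L (IsCMField.complexConj L) 1 (Matrix.diagonal dW)) ⧸
      (UnitaryGroup.toAdelic ↥(maximalRealSubfield L) L (IsCMField.complexConj L) 1 (Matrix.diagonal dW)).range))
    [IsFiniteMeasure μ] (Φ : piSchwartzBruhat ↥(maximalRealSubfield L) (Fin n))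
    (f : C(↥(UnitaryGroup.adelic ↥(maximalRealSubfield L) L (IsCMField.complexConj L) 1 (Matrix.diagonal dW)) ⧸
      (UnitaryGroup.toAdelic ↥(maximalRealSubfield L) L (IsCMField.complexConj L) 1 (Matrix.diagonal dW)).range, ℂ)) :
    haveI := normal_range_toAdelic_line L dW
    (cmThetaKernelDatum L e dV hdV hdV0 dW hdW hdW0 hGR hρ SK hSK).thetaLift μ Φ f ∈
      closure (Submodule.span ℂ (Set.range fun χ : PontryaginDual (↥(UnitaryGroup.adelic ↥(maximalRealSubfield L) L
          (IsCMField.complexConj L) 1 (Matrix.diagonal dW)) ⧸ (UnitaryGroup.toAdelic ↥(maximalRealSubfield L) L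
          (IsCMField.complexConj L) 1 (Matrix.diagonal dW)).range) =>
            (cmThetaKernelDatum L e dV hdV hdV0 dW hdW hdW0 hGR hρ SK hSK).thetaLift μ Φ (charCM χ)) :
        Set C(↥(UnitaryGroup.adelic ↥(maximalRealSubfield L) L (IsCMField.complexConj L) N (Matrix.diagonal dV)) ⧸
          (UnitaryGroup.toAdelic ↥(maximalRealSubfield L) L (IsCMField.complexConj L) N (Matrix.diagonal dV)).range, ℂ)) := by
  haveI := normal_range_toAdelic_line L dW
  letI : CommGroup ↥(UnitaryGroup.adelic ↥(maximalRealSubfield L) L (IsCMField.complexConj L) 1 (Matrix.diagonal dW)) :=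
    { (inferInstance : Group ↥(UnitaryGroup.adelic ↥(maximalRealSubfield L) L (IsCMField.complexConj L) 1
        (Matrix.diagonal dW))) with
      mul_comm := adelic_line_mul_comm L dW }
  haveI : CompactSpace (↥(UnitaryGroup.adelic ↥(maximalRealSubfield L) L (IsCMField.complexConj L) 1 (Matrix.diagonal dW)) ⧸
      (UnitaryGroup.toAdelic ↥(maximalRealSubfield L) L (IsCMField.complexConj L) 1 (Matrix.diagonal dW)).range) :=
    compactSpace_quotient_range_toAdelic_line L dW hdW hdW0
  haveI : T2Space (↥(UnitaryGroup.adelic ↥(maximalRealSubfield L) L (IsCMField.complexConj L) 1 (Matrix.diagonal dW)) ⧸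
      (UnitaryGroup.toAdelic ↥(maximalRealSubfield L) L (IsCMField.complexConj L) 1 (Matrix.diagonal dW)).range) :=
    t2Space_quotient_range_toAdelic L 1 (Matrix.diagonal dW)
  exact ThetaKernelDatum.thetaLift_mem_closure_span_charCM
    (cmThetaKernelDatum L e dV hdV hdV0 dW hdW hdW0 hGR hρ SK hSK) μ Φ f

/-- **`Θ_Φ ≡ 0` on `C([U(⟨d_W⟩)], ℂ)` iff `Θ_Φ(χ) = 0` for every automorphic character `χ` of the CM line** (CM pair
`(U(diag d_V), U(⟨d_W⟩))`, any finite Borel measure): the character theta lifts of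
`UnitaryDualPairThetaLiftGaussianCharacter` generate the whole theta correspondence from the CM line at level `Φ`.
[cite: GelbartRogawski1991, §3.2 p. 457; FleigEtAl2018, §12.3 Definition 12.5 (12.37), p. 296; DeitmarEchterhoff2014,
Prop. 3.5.2] -/
theorem cmThetaKernelDatum_line_thetaLift_eq_zero_iff_forall_charCM
    [CompactSpace (↥(UnitaryGroup.adelic ↥(maximalRealSubfield L) L (IsCMField.complexConj L) N (Matrix.diagonal dV)) ⧸
      (UnitaryGroup.toAdelic ↥(maximalRealSubfield L) L (IsCMField.complexConj L) N (Matrix.diagonal dV)).range)]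
    [MeasurableSpace (↥(UnitaryGroup.adelic ↥(maximalRealSubfield L) L (IsCMField.complexConj L) 1 (Matrix.diagonal dW)) ⧸
      (UnitaryGroup.toAdelic ↥(maximalRealSubfield L) L (IsCMField.complexConj L) 1 (Matrix.diagonal dW)).range)]
    [BorelSpace (↥(UnitaryGroup.adelic ↥(maximalRealSubfield L) L (IsCMField.complexConj L) 1 (Matrix.diagonal dW)) ⧸
      (UnitaryGroup.toAdelic ↥(maximalRealSubfield L) L (IsCMField.complexConj L) 1 (Matrix.diagonal dW)).range)]
    (μ : Measure (↥(UnitaryGroup.adelic ↥(maximalRealSubfield L) L (IsCMField.complexConj L) 1 (Matrix.diagonal dW)) ⧸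
      (UnitaryGroup.toAdelic ↥(maximalRealSubfield L) L (IsCMField.complexConj L) 1 (Matrix.diagonal dW)).range))
    [IsFiniteMeasure μ] (Φ : piSchwartzBruhat ↥(maximalRealSubfield L) (Fin n)) :
    haveI := normal_range_toAdelic_line L dW
    (∀ f : C(↥(UnitaryGroup.adelic ↥(maximalRealSubfield L) L (IsCMField.complexConj L) 1 (Matrix.diagonal dW)) ⧸
        (UnitaryGroup.toAdelic ↥(maximalRealSubfield L) L (IsCMField.complexConj L) 1 (Matrix.diagonal dW)).range, ℂ),
        (cmThetaKernelDatum L e dV hdV hdV0 dW hdW hdW0 hGR hρ SK hSK).thetaLift μ Φ f = 0) ↔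
      ∀ χ : PontryaginDual (↥(UnitaryGroup.adelic ↥(maximalRealSubfield L) L (IsCMField.complexConj L) 1
          (Matrix.diagonal dW)) ⧸ (UnitaryGroup.toAdelic ↥(maximalRealSubfield L) L (IsCMField.complexConj L) 1
          (Matrix.diagonal dW)).range),
        (cmThetaKernelDatum L e dV hdV hdV0 dW hdW hdW0 hGR hρ SK hSK).thetaLift μ Φ (charCM χ) = 0 := by
  haveI := normal_range_toAdelic_line L dW
  letI : CommGroup ↥(UnitaryGroup.adelic ↥(maximalRealSubfield L) L (IsCMField.complexConj L) 1 (Matrix.diagonal dW)) :=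
    { (inferInstance : Group ↥(UnitaryGroup.adelic ↥(maximalRealSubfield L) L (IsCMField.complexConj L) 1
        (Matrix.diagonal dW))) with
      mul_comm := adelic_line_mul_comm L dW }
  haveI : CompactSpace (↥(UnitaryGroup.adelic ↥(maximalRealSubfield L) L (IsCMField.complexConj L) 1 (Matrix.diagonal dW)) ⧸
      (UnitaryGroup.toAdelic ↥(maximalRealSubfield L) L (IsCMField.complexConj L) 1 (Matrix.diagonal dW)).range) :=
    compactSpace_quotient_range_toAdelic_line L dW hdW hdW0
  haveI : T2Space (↥(UnitaryGroup.adelic ↥(maximalRealSubfield L) L (IsCMField.complexConj L) 1 (Matrix.diagonal dW)) ⧸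
      (UnitaryGroup.toAdelic ↥(maximalRealSubfield L) L (IsCMField.complexConj L) 1 (Matrix.diagonal dW)).range) :=
    t2Space_quotient_range_toAdelic L 1 (Matrix.diagonal dW)
  exact ThetaKernelDatum.thetaLift_eq_zero_iff_forall_charCM
    (cmThetaKernelDatum L e dV hdV hdV0 dW hdW hdW0 hGR hρ SK hSK) μ Φ

end Line

/-! ### Build-lane note
As in the lineage (ops-buildfix G11b-3): the public theorems whose statements unfold to the theta-kernel data are tagged
`[implicit_reducible]` only to keep them out of the library-suggestion index computed at `.olean` export. -/
set_option allowUnsafeReducibility true in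
attribute [implicit_reducible]
  cmThetaKernelDatum_line_thetaLift_mem_closure_span_charCM
  cmThetaKernelDatum_line_thetaLift_eq_zero_iff_forall_charCM

end UnitaryDualPair

end Literature.NumberTheory.GelbartRogawski1991

end
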